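import Literature.NumberTheory.EllipticCurves.BinaryQuarticRealStabilizer
import Literature.NumberTheory.EllipticCurves.BinaryQuarticIrreducibleDiscProofs
import HarnessLib

/-!
# Bhargava–Shankar, Lemma 2.2 for the integral sets `V_ℤ^{(i)}`: `n₀ = n₂ = 4`, `n₁ = 2`

`Proofs` companion (theorems only: no definitions, no named facts) of
`BinaryQuarticRealStabilizer.lean`, which proves Bhargava–Shankar's Lemma 2.2 (*Binary quartic
forms having bounded invariants, and the boundedness of the average rank of elliptic curves*, Ann. of
Math. (2) 181 (2015) 191–242): the stabiliser of a real binary quartic form with `Δ ≠ 0` in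
`GL₂(ℝ)` has order `8` if `Δ > 0` and `4` if `Δ < 0` (`ncard_substStabilizer_of_disc_pos/neg`), and
`#Stab_{PGL₂(ℝ)} = 4` resp. `2` (`pgl2StabilizerCard_real`). This file only transcribes these to the
tree's integral sets `fourRealRoots = V_ℤ^{(0)}`, `twoRealRoots = V_ℤ^{(1)}`,
`noRealRoots = V_ℤ^{(2)}` of `BinaryQuarticForms.lean`, i.e. the sentence of §2.1: "for
`i = 0, 1, 2+`, and `2−`, let `2·nᵢ` denote the cardinality of the stabilizer in `GL₂(ℝ)` of an
irreducible element `v ∈ V^{(i)}_ℝ`. Then, by Lemma 2.2, we have `n₀ = 4`, `n₁ = 2`, `n₂₊ = 4`,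
and `n₂₋ = 4`" (for `V_ℤ^{(2)}`, irreducibility supplies `Δ ≠ 0`, hence `Δ > 0` for a definite
form).

(An earlier revision of this file re-proved Lemma 2.2 from `BinaryQuarticStabilizer` by an
independent real-root count; that material duplicated `BinaryQuarticRealStabilizer.lean` and
`Literature/Algebra/Polynomial/RealCubicRoots.lean` and has been withdrawn in their favour.)

## References

* M. Bhargava, A. Shankar, Ann. of Math. (2) 181 (2015) 191–242 = arXiv:1006.1002, Lemma 2.2 and
  §2.1 (`nᵢ`). [cite: BhargavaShankarAnnals2015, Lemma 2.2 and §2.1 (arXiv:1006.1002v2 numbering)]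
-/

noncomputable section

open scoped Classical

namespace Literature.NumberTheory.EllipticCurves

namespace BinaryQuartic

/-- A definite real form with `Δ ≠ 0` has `Δ > 0` (a form with `Δ < 0` has a real zero,
`not_isDefinite_of_disc_neg`). [cite: BhargavaShankarAnnals2015, §2.1 (V_ℝ^{(2)} has 4I³ − J² > 0)] -/
theorem disc_pos_of_isDefinite {f : BinaryQuartic ℝ} (hdef : f.IsDefinite) (hΔ : f.disc ≠ 0) :
    0 < f.disc := by
  rcases lt_or_gt_of_ne hΔ with h | h
  · exact absurd hdef (not_isDefinite_of_disc_neg f h)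
  · exact h

/-- **`2n₀ = 8`, `2n₁ = 4`, `2n₂ = 8` (Bhargava–Shankar 2015, §2.1, from Lemma 2.2)** for the
integral sets: the stabiliser in `GL₂(ℝ)` of (the real form of) `f` has order `8` for
`f ∈ V_ℤ^{(0)}`, `4` for `f ∈ V_ℤ^{(1)}`, and `8` for an irreducible `f ∈ V_ℤ^{(2)}`.
[cite: BhargavaShankarAnnals2015, §2.1 (n₀ = 4, n₁ = 2, n₂± = 4) and Lemma 2.2 (arXiv:1006.1002v2 numbering)] -/
theorem ncard_substStabilizer_of_mem_realTypes (f : BinaryQuartic ℤ) :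
    (f ∈ fourRealRoots → (substStabilizer (f.map (Int.castRingHom ℝ))).ncard = 8) ∧
    (f ∈ twoRealRoots → (substStabilizer (f.map (Int.castRingHom ℝ))).ncard = 4) ∧
    (f ∈ noRealRoots → f.IsIrreducible → (substStabilizer (f.map (Int.castRingHom ℝ))).ncard = 8) := by
  have hdisc : (f.map (Int.castRingHom ℝ)).disc = (f.disc : ℝ) := by rw [disc_map, eq_intCast]
  refine ⟨fun hf ↦ ?_, fun hf ↦ ?_, fun hf hirr ↦ ?_⟩
  · exact ncard_substStabilizer_of_disc_pos (by rw [hdisc]; exact_mod_cast hf.1)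
  · exact ncard_substStabilizer_of_disc_neg (by rw [hdisc]; exact_mod_cast (show f.disc < 0 from hf))
  · refine ncard_substStabilizer_of_disc_pos (disc_pos_of_isDefinite hf ?_)
    rw [hdisc, Int.cast_ne_zero]
    exact disc_ne_zero_of_isIrreducible hirr

/-- **`n₀ = 4`, `n₁ = 2`, `n₂ = 4`** as `PGL₂(ℝ)`-stabiliser orders for the integral sets
(`pgl2StabilizerCard_real`). [cite: BhargavaShankarAnnals2015, §2.1 (nᵢ) and Lemma 2.2 (arXiv:1006.1002v2 numbering)] -/
theorem pgl2StabilizerCard_of_mem_realTypes (f : BinaryQuartic ℤ) :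
    (f ∈ fourRealRoots → pgl2StabilizerCard (f.map (Int.castRingHom ℝ)) = 4) ∧
    (f ∈ twoRealRoots → pgl2StabilizerCard (f.map (Int.castRingHom ℝ)) = 2) ∧
    (f ∈ noRealRoots → f.IsIrreducible → pgl2StabilizerCard (f.map (Int.castRingHom ℝ)) = 4) := by
  have hdisc : (f.map (Int.castRingHom ℝ)).disc = (f.disc : ℝ) := by rw [disc_map, eq_intCast]
  refine ⟨fun hf ↦ ?_, fun hf ↦ ?_, fun hf hirr ↦ ?_⟩
  · have h : 0 < (f.map (Int.castRingHom ℝ)).disc := by rw [hdisc]; exact_mod_cast hf.1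
    rw [pgl2StabilizerCard_real h.ne', if_pos h]
  · have h : (f.map (Int.castRingHom ℝ)).disc < 0 := by
      rw [hdisc]; exact_mod_cast (show f.disc < 0 from hf)
    rw [pgl2StabilizerCard_real h.ne, if_neg (not_lt.mpr h.le)]
  · have hΔ : (f.map (Int.castRingHom ℝ)).disc ≠ 0 := by
      rw [hdisc, Int.cast_ne_zero]; exact disc_ne_zero_of_isIrreducible hirr
    have h := disc_pos_of_isDefinite hf hΔ
    rw [pgl2StabilizerCard_real hΔ, if_pos h]

end BinaryQuartic

end Literature.NumberTheory.EllipticCurves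

end
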